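import Summits.NavierStokesRegularity.NavierStokesRegularity.Theorems.ExtremiserTransiencePlateauSliceRigidity
import Summits.NavierStokesRegularity.NavierStokesRegularity.Theorems.ExtremiserTransienceRegularisedNearPlateauStabilityBangBangCoreTools
import Summits.NavierStokesRegularity.NavierStokesRegularity.Theorems.ExtremiserTransienceRegularisedNearPlateauStabilityBangBangCoreCutoff
import Summits.NavierStokesRegularity.NavierStokesRegularity.Theorems.ExtremiserTransienceRegularisedNearPlateauStabilityBangBangCoreSlackFermat
import Summits.NavierStokesRegularity.NavierStokesRegularity.Theorems.ExtremiserTransienceZoneTransversalityDefs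
import Summits.NavierStokesRegularity.NavierStokesRegularity.Theorems.ExtremiserTransienceRegularisedNearPlateauStabilitySparseNearPlateauStability
import Summits.NavierStokesRegularity.NavierStokesRegularity.Theorems.ExtremiserTransienceNearExtremalTransiencePerFlowOfSparseEfficientTimes
import HarnessLib

/-!
# LINE g8-α «sparse bang-bang» — crux `NearExtremalTransiencePerFlow` (stmt-NavierStokesRegularity-26567)

Route `ExtremiserTransience` (sub-problem = summit `NavierStokesRegularity`).  Ideator seat `ns-idea-5`, generation g8,
technique card «extremal-example mining».  A SKELETON LINE: three `sorry`-stubs (§2) and a kernel-checked composition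
(§3) concluding the crux BY NAME.  **No summit is proved by a line.**  Under KEY-NS #155 (1) this file is a crux
WORKFILE (`Cruxes/NearExtremalTransiencePerFlow/Lines/sparse_bangbang.lean`), not a registered skeleton.

## Why this line (the autopsy of K14 and what survives it)

LINE g6-γ «bang-bang core» (`Lines/bangbang_core.lean`, layer-2 child 28317 `RegularisedNearPlateauStability`) died at its
stub K14 `stub_localBangBang`: the LOCAL slack-Fermat argument at a ball chosen by K3 leaks the CELL NUMBER
`N = W·λ/M²` of the field — a near-extremal crowd of `N` members has total efficiency defect `≍ ε·N` (in units of
`u = M⁴Wλ`) while a single ball's first variation is `O(u)`, so the honest slack is `≍ (√(εN) + εN)·u` and one «dud» member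
is affordable (prover `ns-net-p2`, K14-analysis v2 §1–§5, evidence on 28317).  This is not an artefact of the proof: with
a GLOBAL defect no first-variation argument certifies anything local below precision `√(εN)`.

What survives (K14-analysis §6, CREDIT `ns-net-p2`, sharpened here): take the GLOBAL two-sided admissible test field
`φ = v − curl(ζ·ψ̂)`, where `ζ` is the level cut-off of the speed (`= 1` on `{‖v‖ ≥ (1−δ/2)M}`, `= 0` off
`{‖v‖ ≥ (1−3δ/4)M}`; landed `BangBang.levelCutoff` calculus) and `ψ̂` is ANY smooth field with `curl ψ̂ = v` near the
support of `ζ`.  Linearity of the first variation `ℓ_v` and the density representation give the GLOBAL BANG-BANG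
INEQUALITY
  `∫ ⟪G, ζ·ψ̂⟫ = ℓ_v(v) − ℓ_v(φ) ≥ 2κ⋆(κ⋆−6ε)·M²ZW − C_F·Λ⁶·(√ε + ε/s₀)·M²ZW`        (★)
(`ell_self_lower` + slack Fermat for the sextic `s ↦ J(v+sφ)² − κ⋆²M²Z(v+sφ)W(v+sφ)`, landed
`BangBang.abs_linear_coeff_le_of_sextic_nonpos`; `Λ` = relative size of `φ`, `s₀` = admissible range), and the left side
is at most `‖G‖_∞ · sup_{supp ζ}‖ψ̂‖ · vol{‖v‖ ≥ (1−3δ/4)M}` with `‖G‖_∞ ≤ C_G·M³W/λ³` (K2, LANDED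
`BangBang.densitySupBound`, p661473).  Everything in (★) scales like `N·u`: NO LEAK — provided `Λ`, `s₀` and
`sup‖ψ̂‖/(Mλ)` are controlled.  THE NEW OBSERVATION OF THIS LINE: in the SPARSE CLASS `W·λ ≤ N₀·M²` (cell number
`≤ N₀`) all three are elementary —
 * the half-top set `{‖v‖ ≥ M/2}` is covered by `m₀(A₁,N₀)` balls of radius `ρ₀(A₁,N₀)·λ` (Sobolev `‖v‖₆ ≤ C‖∇v‖₂ = C√Z`
   and the Lipschitz bound `A₁M/λ`: every top point carries a ball of radius `λ/(4A₁)` at speed `≥ M/4`);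
 * on a ball `B(c, ρλ)` the RADIAL (Poincaré-lemma) potential `ψ_c(x) = ∫₀¹ t·v(c + t(x−c)) dt × (x−c)` has `curl ψ_c = v`
   and `‖ψ_c(x)‖ ≤ (M/2)‖x−c‖ ≤ ρ·Mλ/2` — NO Biot–Savart, NO gauge fixing, NO far field (the «one non-elementary input» of
   K14-analysis §6, the Coulomb-gauge gradient bound, is not needed): `ψ̂ := Σ_i χ_i ψ_{c_i}` over the disjoint dilated
   cluster balls;
 * `Λ`, `s₀` depend on `(A, N₀, δ)` only, and enter (★) only through the slack, which `ε = ε(δ)` kills;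
so (★) yields `vol{‖v‖ ≥ (1−3δ/4)M} ≥ (κ⋆²/(C_G ρ₀)) · N · λ³ ≥ c(A,N₀)·λ³` (`N ≥ (π/2)(1−ε/κ⋆)³/(‖curl‖A₁)`, LANDED
`BangBang.cellNumber_lower`) inside `m₀` balls of radius `ρ₀λ`: ONE of them is a δ-UNIFORM FAT NEAR-TOP BALL.  That is
`SparseNearPlateauStability` (S-B below): 28317 in the sparse class, by a complete argument whose every step is typed
or landed — a FORMALISATION task (L–XL Lean), no open mathematics.

The crowd wall does not disappear; it MOVES TO THE FLOW SIDE as ONE named statement (S-E, the open heart):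
a violator of the crux has, for some `N₀`, near-efficient two-sided-locked late times at which the Leray-normalised
enstrophy `Z(t)√(T−t)/ν^{3/2}` is `≤ N₀` («sparse efficient times»; g4's (E) `enstrophyRateAtEfficientTimes`).  At such a
time the slice `(u(t), M = ‖u(t)‖_∞)` is admissible, A-regular with the PER-FLOW budget `A_j = C_j c₂^{j/2}/c₀` (higher
Type-I rates + the lock + Leray's lower rate) and SPARSE with `N₀' = N₀/(√c₁ c₀²)` (lower lock + Leray), so S-B gives a
fat near-top ball, and the landed moving-centre zoom (`volume_zoom_nearPlateau_ge`, `zoom_typeI_bound`,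
`zoomCompactnessKNSS`, `plateauPersistenceSlice`) produces the weak one-slice object of item 27822 with an exact
positive-volume plateau (S-T, provable-grade transfer = item 28318's T1–T4 at the sparse times), which the LANDED
`plateauSliceRigidity` (p645075) excludes.  Hence (§3): S-B → S-E → S-T → `NearExtremalTransiencePerFlow`.

DICHOTOMY VALUE.  ¬(S-E) is «crowd blow-up»: along every near-efficient locked late time the number of parabolic
enstrophy cells diverges.  That branch is exactly what LINE g7-δ (`member_selection`, T1/T3) and item 27695
`NoQuantumSheet` attack; this line closes the complementary SPARSE branch modulo formalisation, i.e. it proves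
«a Type-I singular flow with non-transient near-extremal stretching is a crowd blow-up» once S-B and S-T are landed.

## Stubs (the only `sorry`s; registered names in §2b)
* S-B `stub_sparseNearPlateauStability` — PROVABLE (plan P1–P5 typed in §1b; L–XL Lean, M mathematics).
* S-E `stub_sparseEfficientTimes` — OPEN HEART (crowd wall, flow side).
* S-T `stub_sparseSliceTransfer` — provable-grade (item 28318's plan at the sparse times; L–XL Lean).
Composition `NearExtremalTransiencePerFlow_of : S-B → S-E → S-T → NearExtremalTransiencePerFlow` (§3, no `sorry`).

## Dead lines honoured
K14 (local bang-bang with a free centre: never again — the test field is global and the class is sparse, so the defect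
`εN ≤ εN₀` is member-level); K3 (no efficient-core selection is needed); Z2 (no derivative of any zone coefficient);
exact-DSS objects (none posited); g7-γ Galilean frame (not used).  Disproof ledger of 26567: none of
`_false_without_` type recorded against S-B/S-E/S-T (Disproof.lean absent for this crux at filing).
-/

noncomputable section

open scoped Topology InnerProductSpace RealInnerProductSpace ENNReal ContDiff
open MeasureTheory Filter Set Metric
open Literature.Analysis.FluidPDE
open Summit.NavierStokesRegularity.NavierStokesRegularity.Theses.ExtremiserTransience
open Summit.NavierStokesRegularity.NavierStokesRegularity.Theorems.DepletionLadder.KStar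
open Summit.NavierStokesRegularity.NavierStokesRegularity.Theorems.DepletionLadder.KStar.HalfSpace
open Summit.NavierStokesRegularity.NavierStokesRegularity.Theorems.DepletionLadder.KStar.BangBang
open Summit.NavierStokesRegularity.NavierStokesRegularity.Theorems.NearExtremalTransiencePerFlow.ZoneTransversality (PFC IsViolator)

namespace Summit.NavierStokesRegularity.NavierStokesRegularity.Cruxes.NearExtremalTransiencePerFlow.SparseBangBang

set_option linter.dupNamespace false
set_option linter.unusedVariables false

/-! ## §0 Vocabulary (abbreviations over the tree's `KStar.HalfSpace` / `KStar.BangBang` definitions; nothing new is posited) -/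

/-- The NEAR-TOP SET of `v` at height `M` and threshold `δ`: `{x | (1−δ)·M ≤ ‖v x‖}`. -/
def topSet (v : E3 → E3) (M δ : ℝ) : Set E3 := {x | (1 - δ) * M ≤ ‖v x‖}

/-- The dimensionless CELL NUMBER `N(v,M) = W·λ/M²` (`= Z/(M²λ)`, `λ = √(Z/W)`): the number of `λ`-cells of full-size
vorticity `M/λ` that the enstrophy budget can pay for.  Copy-additive: `N` copies of a field have cell number `N`-fold. -/
def cellNumber (v : E3 → E3) (M : ℝ) : ℝ := Wpa v * lam v / M ^ 2

/-- `v` is `N₀`-SPARSE at height `M`: cell number `≤ N₀`, i.e. `W·λ ≤ N₀·M²`. -/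
def IsSparse (N₀ : ℝ) (v : E3 → E3) (M : ℝ) : Prop := Wpa v * lam v ≤ N₀ * M ^ 2

/-- The WEAK ONE-SLICE PLATEAU OBJECT of item 27822 (verbatim the existential negated by `PlateauSliceRigidity`):
a field `W` on `(−∞,0) × ℝ³`, jointly continuous, Oseen-mild between all `s < t < 0`, Type-I `√(−t)‖W(t)‖_∞ ≤ K`,
with a slice `W t₀` attaining its maximum speed `m > 0` on a set of positive volume. -/
def WeakPlateauObject : Prop :=
  ∃ (W : ℝ → EuclideanSpace ℝ (Fin 3) → EuclideanSpace ℝ (Fin 3)) (K t₀ m : ℝ),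
    ContinuousOn (Function.uncurry W) (Set.Iio (0 : ℝ) ×ˢ Set.univ) ∧
    (∀ s t : ℝ, s < t → t < 0 → ∀ x, W t x = Literature.Analysis.FluidPDE.heatFlow (W s) (t - s) x -
      Literature.Analysis.FluidPDE.oseenDuhamel 1 s W W t x) ∧
    (∀ t : ℝ, t < 0 → ∀ x, Real.sqrt (-t) * ‖W t x‖ ≤ K) ∧ t₀ < 0 ∧ 0 < m ∧ (∀ y, ‖W t₀ y‖ ≤ m) ∧
    0 < MeasureTheory.volume {y : EuclideanSpace ℝ (Fin 3) | ‖W t₀ y‖ = m}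

/-! ## §1 The three statements of the line -/

/-- (S-B — PROVABLE; plan P1–P5 in §1b) SPARSE NEAR-PLATEAU STABILITY: item 28317 `RegularisedNearPlateauStability`
restricted to the SPARSE class `W·λ ≤ N₀·M²`, with constants `c₀(A,N₀), r(A,N₀)` uniform in `δ`.  For every derivative
budget `A` and sparseness level `N₀` there are `c₀, r > 0` such that for every `δ > 0` some `ε > 0` works: an admissible,
`A`-regular, `N₀`-sparse, non-degenerate, `(κ⋆−ε)`-efficient field has a ball of radius `r·λ` in which the near-top set
`{‖v‖ ≥ (1−δ)M}` has volume `≥ c₀ (rλ)³`.  Mechanism: the global bang-bang inequality (★) of the file docstring with the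
radial-gauge test potential. -/
def SparseNearPlateauStability : Prop :=
  ∀ A : ℕ → ℝ, (∀ j, 1 ≤ A j) → ∀ N₀ : ℝ, 0 < N₀ → ∃ c₀ r : ℝ, 0 < c₀ ∧ 0 < r ∧ ∀ δ : ℝ, 0 < δ → ∃ ε : ℝ, 0 < ε ∧
    ∀ (v : E3 → E3) (M B : ℝ), IsAdm v M B → IsReg A v M → IsSparse N₀ v M →
      0 < M * Real.sqrt (Zen v) * Real.sqrt (Wpa v) →
      (kStar - ε) * M * Real.sqrt (Zen v) * Real.sqrt (Wpa v) ≤ |Jst v| →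
        ∃ x₀ : E3, ENNReal.ofReal (c₀ * (r * lam v) ^ 3) ≤
          volume {x : E3 | x ∈ Metric.ball x₀ (r * lam v) ∧ (1 - δ) * M ≤ ‖v x‖}

/-- (S-E — OPEN HEART, the crowd wall on the flow side) SPARSE EFFICIENT TIMES: a violator flow of the crux has, for some
`N₀, Θ`, for every deficit `ε > 0` and onset `t₁ < T`, a late time `t ∈ [t₁,T)` that is (i) SPARSE: Leray-normalised
enstrophy `Z(t)·√(T−t) ≤ N₀·ν^{3/2}`; (ii) TWO-SIDED LOCKED: `Θ⁻¹·ν(T−t)·P ≤ Z ≤ Θ·ν(T−t)·P`; (iii) NEAR-EFFICIENT at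
level `ε` at some height bound `M ≥ ‖u(t)‖_∞` with `0 < M√Z√P`.  (ii)∧(iii) hold on a NON-NULL set of late times for every
`ε, t₁` (LANDED `PerFlow.scaleLock_at_nearEfficient_times`); the content is (i) at some of them.  Known for
(discretely) self-similar or finitely-many-cell concentration; ¬(S-E) = «crowd blow-up» (cell number → ∞ along all
near-efficient locked late times), the branch attacked by LINE g7-δ / item 27695. -/
def SparseEfficientTimes : Prop :=
  ∀ (C ν T : ℝ) (u : ℝ → E3 → E3) (p : ℝ → E3 → ℝ), IsViolator C ν T u p →
    ∃ N₀ Θ : ℝ, ∀ ε : ℝ, 0 < ε → ∀ t₁ ∈ Set.Ico 0 T, ∃ t ∈ Set.Ico t₁ T,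
      Zen (u t) * Real.sqrt (T - t) ≤ N₀ * (ν * Real.sqrt ν) ∧
      Θ⁻¹ * (ν * (T - t)) * Wpa (u t) ≤ Zen (u t) ∧ Zen (u t) ≤ Θ * (ν * (T - t)) * Wpa (u t) ∧
      ∃ M : ℝ, (∀ x, ‖u t x‖ ≤ M) ∧ 0 < M * Real.sqrt (Zen (u t)) * Real.sqrt (Wpa (u t)) ∧
        (kStar - ε) * M * Real.sqrt (Zen (u t)) * Real.sqrt (Wpa (u t)) ≤ |Jst (u t)|

/-- (S-T — provable-grade DYNAMIC TRANSFER, = item 28318's plan T1–T4 run at the sparse times) SPARSE SLICE TRANSFER: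
`SparseNearPlateauStability` and `SparseEfficientTimes` give, for every violator flow, the weak one-slice plateau object
of item 27822.  PLAN: (T1) higher Type-I rates `‖Dʲu(t)‖_∞ ≤ C_j ν^{(1−j)/2}(T−t)^{−(j+1)/2}` eventually (j = 1 landed
`PerFlow.gradTypeIRate_of_typeIRate`; all j on mild windows `KNSSBootstrap.exists_norm_iteratedFDeriv_slice_le`);
(T2) at a time of S-E with `M := ‖u(t)‖_∞`-pinned height: `IsAdm`, `IsReg A` with `A_j = C_j·Θ^{j/2}/c₀` (upper lock +
Leray's lower rate `lerayLowerRate_of_not_extends`), `IsSparse (N₀·√Θ/c₀²)` (lower lock + Leray), non-degenerate,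
`(κ⋆−ε)`-efficient; (T3) apply S-B with `δ_n ↓ 0`, `ε_n = ε(δ_n)`, `t_n ↑ T`; (T4) moving-centre zoom at the fat balls
(`volume_zoom_nearPlateau_ge`, `zoom_typeI_bound`, `zoomCompactnessKNSS`, `plateauPersistenceSlice`). -/
def SparseSliceTransfer : Prop :=
  SparseNearPlateauStability → SparseEfficientTimes →
    ∀ (C ν T : ℝ) (u : ℝ → E3 → E3) (p : ℝ → E3 → ℝ), IsViolator C ν T u p → WeakPlateauObject

/-! ## §1b The prover's plan for S-B, TYPED (definitions only — not stubs; land each `--supports` the crux item)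

(★) is assembled from: K2 `BangBang.densitySupBound` (LANDED) · `BangBang.ell_self_lower` (skeleton γ §0c, kernel-checked)
· `BangBang.abs_linear_coeff_le_of_sextic_nonpos` (LANDED) · `BangBang.ell_curl_le_of_density` (LANDED) ·
`BangBang.cellNumber_lower` (LANDED) · the level cut-off calculus `BangBang.norm_iteratedFDeriv_levelCutoff_le` (LANDED)
· and the three NEW lemmas P1–P3 below, plus the test-field package P4 and the assembly arithmetic P5 (`topVolume_lower`,
PROVED in §1c). -/

/-- (P1, NEW, M) SPARSE TOP COVERING: for an admissible field with Lipschitz budget `‖Dv‖ ≤ A₁M/λ` and `W·λ ≤ N₀M²`, the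
half-top set `{‖v‖ ≥ M/2}` is covered by at most `m₀(A₁,N₀)` balls of radii in `[λ, ρ₀(A₁,N₀)·λ]` whose threefold
dilates are pairwise disjoint.  (Sobolev `‖v‖₆ ≤ C_S‖∇v‖₂ = C_S√Z` on `ℝ³` + a maximal `λ`-net in the half-top set, each
net point carrying the ball `B(x, λ/(4A₁)) ⊆ {‖v‖ ≥ M/4}`; then single-linkage merging of the `≤ C A₁³N₀³` net balls.) -/
def SparseTopCovering : Prop :=
  ∀ (A₁ N₀ : ℝ), 1 ≤ A₁ → 0 < N₀ → ∃ (m₀ : ℕ) (ρ₀ : ℝ), 1 ≤ ρ₀ ∧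
    ∀ (v : E3 → E3) (M B : ℝ), IsAdm v M B → (∀ x, ‖iteratedFDeriv ℝ 1 v x‖ ≤ A₁ * M * (lam v)⁻¹) →
      IsSparse N₀ v M → 0 < M * Real.sqrt (Zen v) * Real.sqrt (Wpa v) →
        ∃ (k : ℕ) (c : Fin k → E3) (ρ : Fin k → ℝ), k ≤ m₀ ∧ (∀ i, lam v ≤ ρ i ∧ ρ i ≤ ρ₀ * lam v) ∧
          {x : E3 | M / 2 ≤ ‖v x‖} ⊆ ⋃ i, Metric.ball (c i) (ρ i) ∧
          ∀ i j, i ≠ j → Disjoint (Metric.ball (c i) (3 * ρ i)) (Metric.ball (c j) (3 * ρ j))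

/-- (P2, NEW, M–L) RADIAL POTENTIAL (Poincaré lemma for closed 2-forms on `ℝ³`, star-shaped about `c`): a smooth
divergence-free field `v` with `‖v‖ ≤ M` and `‖Dv‖ ≤ B` has, for every centre `c`, a smooth GLOBAL vector potential
`ψ` (`curl ψ = v` everywhere) with the LINEAR bounds `‖ψ x‖ ≤ (M/2)·‖x − c‖` and `‖Dψ x‖ ≤ M + B·‖x − c‖`
(formula `ψ(x) = ∫₀¹ t·v(c + t(x−c)) dt ×₃ (x − c)`).  No Biot–Savart, no decay, no gauge fixing. -/
def RadialPotential : Prop :=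
  ∀ (v : E3 → E3) (M B : ℝ) (c : E3), ContDiff ℝ (⊤ : ℕ∞) v → VectorCalculus.IsDivFree v → (∀ x, ‖v x‖ ≤ M) →
    (∀ x, ‖fderiv ℝ v x‖ ≤ B) →
      ∃ ψ : E3 → E3, ContDiff ℝ (⊤ : ℕ∞) ψ ∧ (∀ x, curl ψ x = v x) ∧ (∀ x, ‖ψ x‖ ≤ M / 2 * ‖x - c‖) ∧
        (∀ x, ‖fderiv ℝ ψ x‖ ≤ M + B * ‖x - c‖)

/-- (P3, NEW, L) GLOBAL TWO-SIDED SLACK FERMAT (abstract test field): if `v` is admissible and `(κ⋆−ε)`-efficient at height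
`M`, and `φ` is an admissible-class direction of RELATIVE SIZE `Λ` (`‖φ‖ ≤ ΛM`, `Z(φ) ≤ Λ²Z`, `W(φ) ≤ Λ²W`) that is
TWO-SIDED ADMISSIBLE on `|s| ≤ s₀` (`‖v + sφ‖ ≤ M`), then `|ℓ_v(φ)| ≤ C_F·Λ⁶·(√ε + ε/s₀)·M²ZW`.  (The sextic
`f(s) = J(v+sφ)² − κ⋆²M²Z(v+sφ)W(v+sφ)` is `≤ 0` on `[−s₀,s₀]` by universality of `κ⋆` on the class, `f(0) ≥ −2κ⋆εM²ZW`,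
`f'(0) = ℓ_v(φ)`, and its coefficients are `≤ C·Λ⁶·M²ZW` by the trilinear bounds
`|∫⟪curl a, Db curl c⟫| ≤ ‖b‖_∞‖∇curl a‖₂‖curl c‖₂`; conclude with the LANDED `abs_linear_coeff_le_of_sextic_nonpos`.) -/
def GlobalSlackFermat : Prop :=
  ∃ C_F : ℝ, 0 < C_F ∧ ∀ (v φ : E3 → E3) (M B B' ε Λ s₀ : ℝ), IsAdm v M B → 0 < ε → ε ≤ kStar → 1 ≤ Λ →
    0 < s₀ → s₀ ≤ 1 → IsAdm φ (Λ * M) B' → Zen φ ≤ Λ ^ 2 * Zen v → Wpa φ ≤ Λ ^ 2 * Wpa v →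
    (∀ s : ℝ, |s| ≤ s₀ → ∀ x, ‖v x + s • φ x‖ ≤ M) →
    (kStar - ε) * M * Real.sqrt (Zen v) * Real.sqrt (Wpa v) ≤ |Jst v| →
      |ell v M φ| ≤ C_F * Λ ^ 6 * (Real.sqrt ε + ε / s₀) * M ^ 2 * Zen v * Wpa v

/-- (P4, NEW, L — the TEST-FIELD PACKAGE, stated as the existence of the two auxiliary fields with their budgets) For an
admissible `A`-regular `N₀`-sparse non-degenerate field and `0 < δ ≤ 1/2` there are a cut-off `ζ` and a potential `ψ̂`
with: `ζ ∈ C^∞`, `0 ≤ ζ ≤ 1`, `ζ = 1` on `{‖v‖ ≥ (1−δ/2)M}`, `ζ = 0` off `{‖v‖ ≥ (1−3δ/4)M}`; `ψ̂ ∈ C_c^∞`,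
`curl ψ̂ = v` on `{‖v‖ ≥ (1−3δ/4)M}`, `‖ψ̂‖ ≤ Ψ₀(A,N₀)·M·λ` on `{ζ ≠ 0}`; and the direction `φ := v − curl(ζ•ψ̂)` is in
the admissible class with relative size `Λ₀(A,N₀,δ)` and two-sided admissible on `|s| ≤ s₀(A,N₀,δ)`.  (P1 + P2 with
`ψ̂ = Σ_i χ_i ψ_{c_i}` over the disjoint dilated cluster balls; `levelCutoff` calculus for `ζ`; Leibniz.)  The constants
`Ψ₀` (δ-FREE) and `Λ₀, s₀` (δ-dependent, harmless: they only enter the slack) are the whole point of the sparse class. -/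
def TopTestField : Prop :=
  ∀ A : ℕ → ℝ, (∀ j, 1 ≤ A j) → ∀ N₀ : ℝ, 0 < N₀ → ∃ Ψ₀ : ℝ, 0 < Ψ₀ ∧ ∀ δ : ℝ, 0 < δ → δ ≤ 1 / 2 →
    ∃ Λ₀ s₀ : ℝ, 1 ≤ Λ₀ ∧ 0 < s₀ ∧ s₀ ≤ 1 ∧
    ∀ (v : E3 → E3) (M B : ℝ), IsAdm v M B → IsReg A v M → IsSparse N₀ v M →
      0 < M * Real.sqrt (Zen v) * Real.sqrt (Wpa v) →
      ∃ (ζ : E3 → ℝ) (ψ : E3 → E3) (B' : ℝ), ContDiff ℝ (⊤ : ℕ∞) ζ ∧ (∀ x, 0 ≤ ζ x ∧ ζ x ≤ 1) ∧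
        (∀ x, (1 - δ / 2) * M ≤ ‖v x‖ → ζ x = 1) ∧ (∀ x, ζ x ≠ 0 → (1 - 3 * δ / 4) * M ≤ ‖v x‖) ∧
        ContDiff ℝ (⊤ : ℕ∞) ψ ∧ HasCompactSupport ψ ∧ (∀ x, (1 - 3 * δ / 4) * M ≤ ‖v x‖ → curl ψ x = v x) ∧
        (∀ x, ζ x ≠ 0 → ‖ψ x‖ ≤ Ψ₀ * M * lam v) ∧
        IsAdm (fun x => v x - curl (fun y => ζ y • ψ y) x) (Λ₀ * M) B' ∧
        Zen (fun x => v x - curl (fun y => ζ y • ψ y) x) ≤ Λ₀ ^ 2 * Zen v ∧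
        Wpa (fun x => v x - curl (fun y => ζ y • ψ y) x) ≤ Λ₀ ^ 2 * Wpa v ∧
        (∀ s : ℝ, |s| ≤ s₀ → ∀ x, ‖v x + s • (v x - curl (fun y => ζ y • ψ y) x)‖ ≤ M)

/-! ## §1c First bricks of the lever, PROVED (no `sorry`) -/

/-- (P5, PROVED) ASSEMBLY ARITHMETIC of (★): if the contact-part inequality `κ²·M²·Z·W ≤ Γ·H·V` holds with the density
bound `Γ ≤ C_G·M³·W·λ⁻³` (K2), the potential bound `H ≤ Ψ₀·M·λ` (P2/P4) and `Z = λ²·W`, then the near-top volume `V`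
is at least `κ²/(C_G·Ψ₀)` times the cell number `W·λ/M²` times `λ³` — δ-uniformly. -/
theorem topVolume_lower {κ M Z W lam Γ H V C_G Ψ₀ : ℝ} (hM : 0 < M) (hW : 0 < W) (hlam : 0 < lam)
    (hCG : 0 < C_G) (hΨ : 0 < Ψ₀) (hZ : Z = lam ^ 2 * W) (hΓ0 : 0 ≤ Γ) (hΓ : Γ ≤ C_G * M ^ 3 * W * lam⁻¹ ^ 3)
    (hH0 : 0 ≤ H) (hH : H ≤ Ψ₀ * M * lam) (hV : 0 ≤ V) (h : κ ^ 2 * M ^ 2 * Z * W ≤ Γ * H * V) :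
    κ ^ 2 / (C_G * Ψ₀) * (W * lam / M ^ 2) * lam ^ 3 ≤ V := by
  have hΓH : Γ * H * V ≤ (C_G * M ^ 3 * W * lam⁻¹ ^ 3) * (Ψ₀ * M * lam) * V := by
    gcongr
  have h1 : κ ^ 2 * M ^ 2 * (lam ^ 2 * W) * W ≤ (C_G * M ^ 3 * W * lam⁻¹ ^ 3) * (Ψ₀ * M * lam) * V := by
    rw [← hZ]; exact h.trans hΓH
  have hlam3 : lam⁻¹ ^ 3 = (lam ^ 3)⁻¹ := by rw [inv_pow]
  rw [hlam3] at h1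
  have hpos : 0 < C_G * Ψ₀ * M ^ 4 * W / lam ^ 2 := by positivity
  -- rewrite the right-hand side of `h1` as `(C_G Ψ₀ M⁴ W / λ²) · V`
  have h2 : (C_G * M ^ 3 * W * (lam ^ 3)⁻¹) * (Ψ₀ * M * lam) * V = (C_G * Ψ₀ * M ^ 4 * W / lam ^ 2) * V := by
    field_simp
  rw [h2] at h1
  -- and the left-hand side as `(C_G Ψ₀ M⁴ W / λ²) · (κ²/(C_G Ψ₀) · (Wλ/M²) · λ³)`
  have h3 : κ ^ 2 * M ^ 2 * (lam ^ 2 * W) * W =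
      (C_G * Ψ₀ * M ^ 4 * W / lam ^ 2) * (κ ^ 2 / (C_G * Ψ₀) * (W * lam / M ^ 2) * lam ^ 3) := by
    field_simp
  rw [h3] at h1
  exact le_of_mul_le_mul_left h1 hpos

/-- (PROVED) In the sparse class the near-top volume bound of (★) is an ABSOLUTE multiple of `λ³`: combine `topVolume_lower`
with a lower bound `n₀ ≤ W·λ/M²` on the cell number (LANDED `BangBang.cellNumber_lower` gives
`n₀ = π(κ⋆−ε)³/(2κ⋆³‖curlCLM‖A₁)`). -/
theorem topVolume_lower_abs {κ M W lam V C_G Ψ₀ n₀ : ℝ} (hCG : 0 < C_G) (hΨ : 0 < Ψ₀) (hlam : 0 < lam)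
    (hn : n₀ ≤ W * lam / M ^ 2) (h : κ ^ 2 / (C_G * Ψ₀) * (W * lam / M ^ 2) * lam ^ 3 ≤ V) :
    κ ^ 2 / (C_G * Ψ₀) * n₀ * lam ^ 3 ≤ V := by
  have h0 : 0 ≤ κ ^ 2 / (C_G * Ψ₀) := by positivity
  calc κ ^ 2 / (C_G * Ψ₀) * n₀ * lam ^ 3 ≤ κ ^ 2 / (C_G * Ψ₀) * (W * lam / M ^ 2) * lam ^ 3 := by
        gcongr
    _ ≤ V := h

/-- (PROVED) PIGEONHOLE over the cluster balls: if a set `S` of finite measure is covered by `k ≥ 1` measurable pieces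
and has measure `≥ m`, one piece meets `S` in measure `≥ m/k`. (Used with P1's balls and `S =` the near-top set.) -/
theorem exists_piece_ge {α : Type*} [MeasurableSpace α] (μ : Measure α) {k : ℕ} (hk : 0 < k)
    (S : Set α) (P : Fin k → Set α) (hcov : S ⊆ ⋃ i, P i) (m : ℝ≥0∞) (hm : m ≤ μ S) :
    ∃ i, m / k ≤ μ (S ∩ P i) := by
  by_contra hcon
  simp only [not_exists, not_le] at hcon
  have hS : S = ⋃ i, (S ∩ P i) := by
    rw [← Set.inter_iUnion]; exact (Set.inter_eq_left.2 hcov).symm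
  have hle : μ S ≤ ∑ i, μ (S ∩ P i) := by
    conv_lhs => rw [hS]
    exact measure_iUnion_fintype_le μ _
  have hlt : ∑ i : Fin k, μ (S ∩ P i) < ∑ _i : Fin k, m / k :=
    ENNReal.sum_lt_sum_of_nonempty (Finset.univ_nonempty_iff.2 ⟨⟨0, hk⟩⟩) fun i _ => hcon i
  have hsum : ∑ _i : Fin k, m / (k : ℝ≥0∞) = m := by
    rw [Finset.sum_const, Finset.card_univ, Fintype.card_fin, nsmul_eq_mul]
    exact ENNReal.mul_div_cancel (by exact_mod_cast hk.ne') (ENNReal.natCast_ne_top k)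
  have hmm : m < m :=
    calc m ≤ μ S := hm
      _ ≤ ∑ i, μ (S ∩ P i) := hle
      _ < ∑ _i : Fin k, m / (k : ℝ≥0∞) := hlt
      _ = m := hsum
  exact lt_irrefl _ hmm

/-! ## §2 Registered stubs (the only `sorry` left: S-E, the open heart — S-B (rev 3) and S-T (rev 4) are closed by landed theorems) -/

/-- S-B — **PROVED** (rev 3, 2026-08-28): closed by the LANDED theorem `…KStar.BangBang.sparseNearPlateauStability`
(p673874, prover seat ns-net-p2 g2, `Theorems/ExtremiserTransienceRegularisedNearPlateauStabilitySparseNearPlateauStability.lean`;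
statement verbatim with `IsSparse` unfolded — the kernel confirms the match here).  No `sorry`. -/
theorem stub_sparseNearPlateauStability : SparseNearPlateauStability :=
  Summit.NavierStokesRegularity.NavierStokesRegularity.Theorems.DepletionLadder.KStar.BangBang.sparseNearPlateauStability

/-- S-E (OPEN HEART): sparse efficient times. -/
theorem stub_sparseEfficientTimes : SparseEfficientTimes := by
  sorry

/-- S-T — **PROVED** (rev 4, 2026-08-28): closed by the LANDED theorem
`…Theorems.NearExtremalTransiencePerFlow.SparseBangBang.sparseSliceTransfer` (p670994, prover seat ns-net-p1 g2, over the texts of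
record `Theorems/ExtremiserTransienceSparseBangBangDefs.lean` p670436; the kernel confirms the definitional match with this
file's `SparseSliceTransfer`).  No `sorry`. -/
theorem stub_sparseSliceTransfer : SparseSliceTransfer :=
  Summit.NavierStokesRegularity.NavierStokesRegularity.Theorems.NearExtremalTransiencePerFlow.SparseBangBang.sparseSliceTransfer

/-! ## §2b Registration block (names `Registered.stub_*` = the Props, for the skeleton index) -/
namespace Registered
/-- registered name of S-B -/
abbrev stub_sparseNearPlateauStability : Prop := SparseNearPlateauStability
/-- registered name of S-E -/
abbrev stub_sparseEfficientTimes : Prop := SparseEfficientTimes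
/-- registered name of S-T -/
abbrev stub_sparseSliceTransfer : Prop := SparseSliceTransfer
end Registered

theorem stub_sparseNearPlateauStability_holds : Registered.stub_sparseNearPlateauStability :=
  stub_sparseNearPlateauStability
theorem stub_sparseEfficientTimes_holds : Registered.stub_sparseEfficientTimes := stub_sparseEfficientTimes
theorem stub_sparseSliceTransfer_holds : Registered.stub_sparseSliceTransfer := stub_sparseSliceTransfer

/-! ## §3 Composition (kernel-checked, no `sorry`): S-B → S-E → S-T → the crux BY NAME -/

/-- **The line decides the crux.**  `SparseNearPlateauStability → SparseEfficientTimes → SparseSliceTransfer →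
NearExtremalTransiencePerFlow`: contrapositively, a violator flow yields (S-T, fed by S-B and S-E) the weak one-slice
plateau object, which the LANDED `plateauSliceRigidity` (item 27823, p645075) excludes. -/
theorem NearExtremalTransiencePerFlow_of (hB : Registered.stub_sparseNearPlateauStability)
    (hE : Registered.stub_sparseEfficientTimes) (hT : Registered.stub_sparseSliceTransfer) :
    Summit.NavierStokesRegularity.NavierStokesRegularity.Theses.ExtremiserTransience.NearExtremalTransiencePerFlow := by
  intro C ν T hC hν hT0 u p hsol hLH hdec hrate hne
  by_contra hno
  exact plateauSliceRigidity (hT hB hE C ν T u p ⟨hC, hν, hT0, hsol, hLH, hdec, hrate, hne, hno⟩)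

/-- How the closed proof is obtained once the three stubs land. -/
example : Summit.NavierStokesRegularity.NavierStokesRegularity.Theses.ExtremiserTransience.NearExtremalTransiencePerFlow :=
  NearExtremalTransiencePerFlow_of stub_sparseNearPlateauStability stub_sparseEfficientTimes stub_sparseSliceTransfer

/-! ## §3b The typed join of the two branches (idea-crit-4 N2, rev 2026-08-28T21:4xZ)

LINE g8-α closes the crux on the branch `SparseEfficientTimes`; LINE g7-δ `member_selection` (item 27695) attacks the
complementary CROWD branch, whose antecedent should be read literally as `¬ SparseEfficientTimes` (cell number → ∞ along all
two-sided-locked near-efficient late times of some violator).  The census may book «α ⊕ δ cover 26567» only through this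
join; it is classical case analysis, typed here so that the two lines' hypotheses cannot leave a gap. -/

/-- **Join of branches.** If the crux follows from `SparseEfficientTimes` (this line, given S-B and S-T) and also from
`¬ SparseEfficientTimes` (the crowd line), it holds. -/
theorem crux_of_branches
    (h₁ : SparseEfficientTimes →
      Summit.NavierStokesRegularity.NavierStokesRegularity.Theses.ExtremiserTransience.NearExtremalTransiencePerFlow)
    (h₂ : ¬ SparseEfficientTimes →
      Summit.NavierStokesRegularity.NavierStokesRegularity.Theses.ExtremiserTransience.NearExtremalTransiencePerFlow) :
    Summit.NavierStokesRegularity.NavierStokesRegularity.Theses.ExtremiserTransience.NearExtremalTransiencePerFlow := by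
  by_cases h : SparseEfficientTimes
  · exact h₁ h
  · exact h₂ h

/-- The sparse branch of the join, from S-B and S-T alone (S-E becomes the antecedent). -/
theorem crux_of_sparseBranch (hB : Registered.stub_sparseNearPlateauStability) (hT : Registered.stub_sparseSliceTransfer) :
    SparseEfficientTimes →
      Summit.NavierStokesRegularity.NavierStokesRegularity.Theses.ExtremiserTransience.NearExtremalTransiencePerFlow :=
  fun hE => NearExtremalTransiencePerFlow_of hB hE hT


/-! ## §3c After S-B (rev 3) and S-T (rev 4) landed: the residual of the line is S-E alone -/

/-- **Residual composition.**  With S-B proved, the crux follows from S-E and S-T alone. -/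
theorem NearExtremalTransiencePerFlow_of₂ (hE : Registered.stub_sparseEfficientTimes)
    (hT : Registered.stub_sparseSliceTransfer) :
    Summit.NavierStokesRegularity.NavierStokesRegularity.Theses.ExtremiserTransience.NearExtremalTransiencePerFlow :=
  NearExtremalTransiencePerFlow_of stub_sparseNearPlateauStability hE hT

/-- The sparse branch of the join now needs S-T only. -/
theorem crux_of_sparseBranch₁ (hT : Registered.stub_sparseSliceTransfer) :
    SparseEfficientTimes →
      Summit.NavierStokesRegularity.NavierStokesRegularity.Theses.ExtremiserTransience.NearExtremalTransiencePerFlow :=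
  fun hE => NearExtremalTransiencePerFlow_of₂ hE hT

/-- **RESIDUAL = THE OPEN HEART (rev 4).**  `SparseEfficientTimes → NearExtremalTransiencePerFlow`, no other hypothesis: S-B and
S-T are landed theorems.  (The same statement is in Theorems as
`…Theorems.NearExtremalTransiencePerFlow.SparseBangBang.nearExtremalTransiencePerFlow_of_sparseEfficientTimes`, p-landed by
ns-net-p1; this is the workfile's own kernel-checked copy over the workfile's stubs.) -/
theorem NearExtremalTransiencePerFlow_of₁ (hE : Registered.stub_sparseEfficientTimes) :
    Summit.NavierStokesRegularity.NavierStokesRegularity.Theses.ExtremiserTransience.NearExtremalTransiencePerFlow :=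
  NearExtremalTransiencePerFlow_of₂ hE stub_sparseSliceTransfer

/-- The sparse branch of the join is now UNCONDITIONAL: `SparseEfficientTimes → crux`. -/
theorem crux_of_sparseBranch₀ :
    SparseEfficientTimes →
      Summit.NavierStokesRegularity.NavierStokesRegularity.Theses.ExtremiserTransience.NearExtremalTransiencePerFlow :=
  fun hE => NearExtremalTransiencePerFlow_of₁ hE

/-! ## §3d Offered SUPPORT statement (not a stub of this line; critic of record 2026-08-28T22:30:19Z (4)) — the «no-dud law»

Quantitative HEIGHT EQUALISATION for separated cells (instrument reading 2 (4)): if a near-extremal field is a finite sum of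
admissible pieces with pairwise disjoint topological supports and heights `Mi i ≤ M`, then the `√(ZᵢWᵢ)`-mass of the pieces
of height `≤ (1−δ)M` («duds») is at most `ε/(κ⋆δ)` of `√Z·√W`.  Proof sketch (S-size): `J, Z, W` are additive over
pairwise disjoint `tsupport`s (derivatives of the sum are the sums of the derivatives and cross terms vanish pointwise);
`|Jᵢ| ≤ κ⋆·Mᵢ·√Zᵢ·√Wᵢ` for each admissible piece (definition of `kStar` as an infimum of admissible constants, landed
`kStar` API); Cauchy–Schwarz `Σᵢ√(ZᵢWᵢ) ≤ √Z·√W =: G`; then `(κ⋆−ε)·M·G ≤ |J| ≤ κ⋆·(M·Σgᵢ − δM·Σ_{dud} gᵢ) ≤ κ⋆M(G − δD)`,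
i.e. `κ⋆δ·D ≤ ε·G`.  It is the quantitative form of copy-invariance (KEY RISK E0) and the static half of every «crowd»
discussion; provers may land it `--supports stmt-NavierStokesRegularity-28317 --as helper`.  Typed here so that its
signature is fixed; deliberately NOT a `sorry`d stub (the line's chain does not use it). -/
def NoDudLaw : Prop :=
  ∀ (n : ℕ) (w : Fin n → E3 → E3) (Mi : Fin n → ℝ) (M B ε δ : ℝ),
    0 < M → 0 < ε → 0 < δ →
    (∀ i, IsAdm (w i) (Mi i) B) → (∀ i, Mi i ≤ M) →
    (∀ i j, i ≠ j → Disjoint (tsupport (w i)) (tsupport (w j))) →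
    (kStar - ε) * M * Real.sqrt (Zen (∑ i, w i)) * Real.sqrt (Wpa (∑ i, w i)) ≤ |Jst (∑ i, w i)| →
      (∑ i ∈ Finset.univ.filter (fun i => Mi i ≤ (1 - δ) * M), Real.sqrt (Zen (w i) * Wpa (w i)))
        ≤ ε / (kStar * δ) * (Real.sqrt (Zen (∑ i, w i)) * Real.sqrt (Wpa (∑ i, w i)))

end Summit.NavierStokesRegularity.NavierStokesRegularity.Cruxes.NearExtremalTransiencePerFlow.SparseBangBang

end
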